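import Mathlib
import HarnessLib
import Summits.NavierStokesRegularity.NavierStokesRegularity.Theorems.PoloidalWindowDoorLrcModEntireThreadPins
import Summits.NavierStokesRegularity.NavierStokesRegularity.Theorems.PoloidalWindowDoorPoloidalWindowRigidityLocalFrozenLaw
import Summits.NavierStokesRegularity.NavierStokesRegularity.Theorems.AdaptedFrequencyTangentFlowTransferAncientPressure
import Summits.NavierStokesRegularity.NavierStokesRegularity.Theorems.PoloidalWindowDoorPoloidalWindowRigidityWindow

/-!
# Route `PoloidalWindowDoor`, item `LrcModEntire` (stmt-NavierStokesRegularity-20428) / crux K2 (stmt-19708) —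
# the PRESSURE PUSH at the threaded vertical hot spot

LEAD of item 20428 ns-poloidal-K2-p3 g10 (`--supports stmt-NavierStokesRegularity-20428 --as helper`).  The thick residue of the item's v5 cut
(`stub_threadedThickEmpty`, far_thread S3) is stated at the vertical HOT SPOT `(−1,0)` of a class profile (`…ExtremalThread.extremalThread`,
`…ThreadPins.exists_threadedHotSpot`: `√(−t)|v₂| ≤ |v₂(−1,0)| ≠ 0`, `∇v₂(−1,0) = 0`, `∂ₜv₂ = v₂/2`, `v₂Δv₂ ≤ 0`).  This file adds the one
DYNAMIC first-order fact at that point — the vertical analogue of `…PoloidalWindowRigidityHotSpot.hotSpot_firstOrder` (K2-p1): the vertical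
momentum equation `∂ₜv₂ + v·∇v₂ = Δv₂ − ∂_z p` evaluated at the hot spot, where the convective term vanishes (thread) and `∂ₜv₂ = v₂/2`, gives
`∂_z p = Δv₂ − v₂/2`, hence with the signed Laplacian pin the PRESSURE PUSHES AGAINST `v₂` WITH A DEFINITE MARGIN:
`v₂(−1,0)·∂_z p(−1,0) ≤ −v₂(−1,0)²/2 < 0`, for EVERY classical pressure `p` of the profile.

* `deriv_apply_coord` — component of a time derivative (plumbing);
* `threadPressure_eq` — `∂_z p(−1,0) = Δv₂(−1,·)(0) − v₂(−1,0)/2` at a threaded hot spot;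
* `threadPressurePush` — `v₂(−1,0)·∂_z p(−1,0) ≤ −v₂(−1,0)²/2`;
* `exists_threadPressurePush` — the same with the class pressure supplied (`exists_isClassicalNSSolutionOn_Iio_of_isTypeIAncientMild`).

WHAT THIS IS NOT: not a claim about Navier–Stokes regularity and not S3 — a signed point identity for its attackers (bears_on LADDER-NS N0). [folklore]
-/

noncomputable section

-- the summit and its single sub-problem share the name (CONVENTIONS §1), as in every Theorems file
set_option linter.dupNamespace false

namespace Summit.NavierStokesRegularity.NavierStokesRegularity.Theorems.PoloidalWindowDoorLrcModEntireThreadPressure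

open MeasureTheory Set Function Filter Topology
open scoped RealInnerProductSpace InnerProductSpace Laplacian ContDiff
open Literature.Analysis Literature.Analysis.FluidPDE Literature.Analysis.UnboundedOperators
open Summit.NavierStokesRegularity.NavierStokesRegularity.Theorems
open Summit.NavierStokesRegularity.NavierStokesRegularity.Theorems.PoloidalWindowDoorLrcModEntireThreadPins
open Summit.NavierStokesRegularity.NavierStokesRegularity.Theorems.PoloidalWindowDoorPoloidalWindowRigidityLocalFrozenLaw
open Summit.NavierStokesRegularity.NavierStokesRegularity.Theorems.PoloidalWindowDoorPoloidalWindowRigidityWindow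

variable {C : ℝ} {v : ℝ → EuclideanSpace ℝ (Fin 3) → EuclideanSpace ℝ (Fin 3)}

/-- Component of a time derivative = time derivative of the component (plumbing). [folklore] -/
theorem deriv_apply_coord {f : ℝ → EuclideanSpace ℝ (Fin 3)} {t : ℝ} (hf : DifferentiableAt ℝ f t) (i : Fin 3) :
    deriv f t i = deriv (fun s => f s i) t := by
  have h := ((EuclideanSpace.proj (𝕜 := ℝ) i).hasFDerivAt.comp_hasDerivAt t hf.hasDerivAt)
  have e : (fun s => f s i) = (EuclideanSpace.proj (𝕜 := ℝ) i) ∘ f := rfl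
  rw [e, h.deriv]
  rfl

/-- **The vertical momentum equation at a threaded hot spot: `∂_z p(−1,0) = Δv₂(−1,·)(0) − v₂(−1,0)/2`.**  Hypotheses: the route's class,
the hot-spot normalisation (`v₂(−1,0) ≠ 0`, `√(−t)|v₂(t,x)| ≤ |v₂(−1,0)|`), and a classical pressure `p` on `t < 0`. [folklore] -/
theorem threadPressure_eq (hrate : HasTypeITimeDecay C v)
    (hcont : ContinuousOn (uncurry v) (Iio (0 : ℝ) ×ˢ univ))
    (hmild : ∀ s t : ℝ, s < t → t < 0 → ∀ x, v t x = heatExtension (v s) (t - s) x - oseenDuhamel 1 s v v t x)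
    (hne : v (-1) 0 2 ≠ 0) (hhot : ∀ t < 0, ∀ x, Real.sqrt (-t) * |v t x 2| ≤ |v (-1) 0 2|)
    {p : ℝ → EuclideanSpace ℝ (Fin 3) → ℝ} (hp : IsClassicalNSSolutionOn (Iio 0) 1 0 v p) :
    gradient (p (-1)) 0 2 = (Δ (fun y => v (-1) y 2)) 0 - v (-1) 0 2 / 2 := by
  have hs : (-1 : ℝ) < 0 := by norm_num
  have hsm : IsSmoothSpaceTimeOn (Iio 0) v := hp.smooth_velocity
  -- the momentum equation at `(−1, 0)`
  have hmom := hp.momentum (-1) hs 0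
  have htd : timeDerivWithin (Iio 0) v (-1) 0 = deriv (fun s => v s 0) (-1) := by
    rw [timeDerivWithin_apply, derivWithin_of_mem_nhds (Iio_mem_nhds hs)]
  rw [htd, convect_apply, one_smul, Pi.zero_apply, Pi.zero_apply, add_zero] at hmom
  -- time-differentiability of `s ↦ v s 0` at `−1`
  have hct : ContDiffAt ℝ ∞ (uncurry v) ((-1 : ℝ), (0 : EuclideanSpace ℝ (Fin 3))) :=
    hsm.contDiffAt isOpen_Iio (mem_Iio.2 hs) 0
  have hd : DifferentiableAt ℝ (uncurry v) ((-1 : ℝ), (0 : EuclideanSpace ℝ (Fin 3))) := hct.differentiableAt (by simp)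
  have hl : DifferentiableAt ℝ (fun s : ℝ => ((s, (0 : EuclideanSpace ℝ (Fin 3))) : ℝ × EuclideanSpace ℝ (Fin 3))) (-1) :=
    differentiableAt_id.prodMk (differentiableAt_const _)
  have hline : DifferentiableAt ℝ (fun s => v s 0) (-1) := by
    have h := hd.comp (-1) hl
    exact h
  -- the slice is smooth
  have hslice : ContDiff ℝ ∞ (v (-1)) := IsSmoothSpaceTimeOn.contDiff_slice (S := Iio 0) (w := v) hsm hs
  have hslice2 : ContDiffAt ℝ 2 (v (-1)) 0 := (hslice.of_le (by norm_cast)).contDiffAt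
  -- components at the hot spot
  have hcomp := congrArg (fun w : EuclideanSpace ℝ (Fin 3) => w 2) hmom
  simp only [PiLp.add_apply, PiLp.sub_apply] at hcomp
  rw [deriv_apply_coord hline 2, threadTimePin hrate hcont hmild hne hhot, threadPin_of_hotSpot hrate hcont hmild hhot (v (-1) 0),
    laplacian_apply_coord hslice2 2] at hcomp
  linarith

/-- **PRESSURE PUSH at the threaded vertical hot spot: `v₂(−1,0)·∂_z p(−1,0) ≤ −v₂(−1,0)²/2`** (for every classical pressure of the profile;
from `threadPressure_eq` and the signed Laplacian pin `v₂Δv₂ ≤ 0` of `…ThreadPins.threadSpacePin`). [folklore] -/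
theorem threadPressurePush (hrate : HasTypeITimeDecay C v)
    (hcont : ContinuousOn (uncurry v) (Iio (0 : ℝ) ×ˢ univ))
    (hmild : ∀ s t : ℝ, s < t → t < 0 → ∀ x, v t x = heatExtension (v s) (t - s) x - oseenDuhamel 1 s v v t x)
    (hne : v (-1) 0 2 ≠ 0) (hhot : ∀ t < 0, ∀ x, Real.sqrt (-t) * |v t x 2| ≤ |v (-1) 0 2|)
    {p : ℝ → EuclideanSpace ℝ (Fin 3) → ℝ} (hp : IsClassicalNSSolutionOn (Iio 0) 1 0 v p) :
    v (-1) 0 2 * gradient (p (-1)) 0 2 ≤ -(v (-1) 0 2) ^ 2 / 2 := by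
  have heq := threadPressure_eq hrate hcont hmild hne hhot hp
  have hsp := threadSpacePin hrate hcont hmild hne hhot
  rw [heq, mul_sub]
  nlinarith [hsp]

/-- **The class pressure pushes against `v₂` at the hot spot** — `threadPressurePush` with the pressure supplied by the class
(`exists_isClassicalNSSolutionOn_Iio_of_isTypeIAncientMild`), in the route's four-hypothesis form. [folklore] -/
theorem exists_threadPressurePush (hrate : HasTypeITimeDecay C v)
    (hcont : ContinuousOn (uncurry v) (Iio (0 : ℝ) ×ˢ univ))
    (hmild : ∀ s t : ℝ, s < t → t < 0 → ∀ x, v t x = heatExtension (v s) (t - s) x - oseenDuhamel 1 s v v t x)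
    (hdiv : ∀ t < 0, VectorCalculus.IsDivFree (v t))
    (hne : v (-1) 0 2 ≠ 0) (hhot : ∀ t < 0, ∀ x, Real.sqrt (-t) * |v t x 2| ≤ |v (-1) 0 2|) :
    ∃ p : ℝ → EuclideanSpace ℝ (Fin 3) → ℝ, IsClassicalNSSolutionOn (Iio 0) 1 0 v p ∧
      gradient (p (-1)) 0 2 = (Δ (fun y => v (-1) y 2)) 0 - v (-1) 0 2 / 2 ∧
      v (-1) 0 2 * gradient (p (-1)) 0 2 ≤ -(v (-1) 0 2) ^ 2 / 2 := by
  obtain ⟨p, hp⟩ := exists_isClassicalNSSolutionOn_Iio_of_isTypeIAncientMild (isTypeIAncientMild_of_class hrate hcont hmild hdiv)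
  exact ⟨p, hp, threadPressure_eq hrate hcont hmild hne hhot hp, threadPressurePush hrate hcont hmild hne hhot hp⟩

/-! ### Appended (LEAD g10, 12:45Z): the signed horizontal HESSIAN at the hot spot (Morse-shape pin for S3) -/

open Summit.NavierStokesRegularity.NavierStokesRegularity.Theorems.LocalSineTubeDoorProfileAlignedWindowRigidityAncient in

/-- **Signed Hessian at the vertical hot spot:** `v₂(−1,0) · D²(v₂(−1,·))(0)[w,w] ≤ 0` for EVERY direction `w` (second-derivative test along the
line `t ↦ t•w` for `σ·v₂(−1,·)`, `σ = sign v₂(−1,0)`, which has a global maximum at `0` by the hot bound on the slice `t = −1`; same engine as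
`…ThreadPins.threadSpacePin`, which is its trace).  So the planar Hessian of `v₂(−1,·)` at the thread is semi-definite with the sign of `−v₂(−1,0)`:
the hypothesis «Morse» of LINE 5 `thread_axis` is exactly «definite». [folklore] -/
theorem threadHessianPin (hrate : HasTypeITimeDecay C v)
    (hcont : ContinuousOn (uncurry v) (Iio (0 : ℝ) ×ˢ univ))
    (hmild : ∀ s t : ℝ, s < t → t < 0 → ∀ x, v t x = heatExtension (v s) (t - s) x - oseenDuhamel 1 s v v t x)
    (hne : v (-1) 0 2 ≠ 0) (hhot : ∀ t < 0, ∀ x, Real.sqrt (-t) * |v t x 2| ≤ |v (-1) 0 2|) (w : EuclideanSpace ℝ (Fin 3)) :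
    v (-1) 0 2 * iteratedFDeriv ℝ 2 (fun y => v (-1) y 2) 0 ![w, w] ≤ 0 := by
  set f : EuclideanSpace ℝ (Fin 3) → ℝ := fun y => v (-1) y 2 with hf
  have hfa : ContDiff ℝ 2 f := by
    have hsl := analyticOnNhd_slice hcont (bdd_of_hasTypeITimeDecay hrate) hmild (by norm_num : (-1 : ℝ) < 0)
    have han : AnalyticOnNhd ℝ f univ := fun y _ =>
      ((EuclideanSpace.proj (𝕜 := ℝ) (2 : Fin 3)).analyticAt _).comp (hsl y (mem_univ _))
    exact han.contDiff
  obtain ⟨σ, hσabs, hσa⟩ : ∃ σ : ℝ, |σ| = 1 ∧ σ * v (-1) 0 2 = |v (-1) 0 2| := by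
    rcases lt_or_gt_of_ne hne with h | h
    · exact ⟨-1, by simp, by rw [abs_of_neg h]; ring⟩
    · exact ⟨1, by simp, by rw [abs_of_pos h]; ring⟩
  have hσle : ∀ y : ℝ, σ * y ≤ |y| := fun y =>
    calc σ * y ≤ |σ * y| := le_abs_self _
      _ = |y| := by rw [abs_mul, hσabs, one_mul]
  have hσ2 : σ * σ = 1 := by
    have h := congrArg (fun r : ℝ => r ^ 2) hσabs
    simp only [sq_abs, one_pow] at h
    nlinarith [h]
  have hφc : ContDiff ℝ 2 (fun t : ℝ => σ * f (0 + t • w)) :=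
    contDiff_const.mul (hfa.comp (contDiff_const.add (contDiff_id.smul contDiff_const)))
  have hmax : IsLocalMax (fun t : ℝ => σ * f (0 + t • w)) 0 := by
    refine Filter.Eventually.of_forall fun t => ?_
    show σ * f (0 + t • w) ≤ σ * f (0 + (0 : ℝ) • w)
    simp only [zero_smul, add_zero, zero_add]
    have hh := hhot (-1) (by norm_num) (t • w)
    have hR : Real.sqrt (-(-1 : ℝ)) = 1 := by norm_num
    rw [hR, one_mul] at hh
    calc σ * f (t • w) ≤ |f (t • w)| := hσle _
      _ ≤ |v (-1) 0 2| := hh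
      _ = σ * f 0 := hσa.symm
  have hA := deriv2_nonpos_of_isLocalMax hφc hmax
  have hB : deriv (deriv (fun t : ℝ => σ * f (0 + t • w))) 0 = σ * iteratedFDeriv ℝ 2 f 0 ![w, w] := by
    rw [← deriv2_line_eq_iteratedFDeriv hfa 0 w]
    have e1 : deriv (fun t : ℝ => σ * f (0 + t • w)) = fun t => σ * deriv (fun t : ℝ => f (0 + t • w)) t :=
      deriv_const_mul_field' σ
    rw [e1, deriv_const_mul_field']
  rw [hB] at hA
  have haσ : v (-1) 0 2 = |v (-1) 0 2| * σ := by
    calc v (-1) 0 2 = (σ * σ) * v (-1) 0 2 := by rw [hσ2, one_mul]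
      _ = (σ * v (-1) 0 2) * σ := by ring
      _ = |v (-1) 0 2| * σ := by rw [hσa]
  rw [haσ, mul_assoc]
  exact mul_nonpos_of_nonneg_of_nonpos (abs_nonneg _) hA

end Summit.NavierStokesRegularity.NavierStokesRegularity.Theorems.PoloidalWindowDoorLrcModEntireThreadPressure
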